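import Summits.HodgeConjecture.CorCM.HypLiu418.A3Liu418BettiThetaPin
import Summits.HodgeConjecture.CorCM.D2Bridge.PrintedCitationHypothesesT
import Literature.NumberTheory.Automorphic.Liu2021.AppendixC.EtaleBettiComparison
import HarnessLib

/-!
# Line `a3-liu418`, stub P AT PLACE — the junction `StubBettiThetaModelAtPlace ⇐ Hyp413 + the pin's Betti pinning`

Cell `hodgecm-mathlib`, fan A, rung A-III; Summits lane `CorCM/HypLiu418/`; seat A-p06.  RULINGS of record: director RULING (P)
2026-08-28T02:22:42Z («stub P junction `Hyp413 → AlbaneseH1Comparison → StubBettiThetaModel`»), A-plan2 03:02:04Z (1)(2) + director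
03:02:54Z: GAP 1 is the registered stub `StubPinBettiPinning` (A-p18; antecedent `StubAlbaneseH1Comparison`, row III-0), R-a (the face
carries `hΦ : ι₁ ∈ Φ.1`), R-b (stub P is assembled by `by_cases` from the AT-PLACE piece — P-body under
`hemb : (NumberField.InfinitePlace.mk ι₁).embedding = ι₁` — closed by THIS junction, and an unowned off-place residual).

`bettiThetaModelAtPlace_of_hyp413_of_pinning`: from the binder `Hyp413` (pack decl `PrintedCitationHypotheses.Hyp413`, by name) and
the CONSEQUENT of `StubPinBettiPinning` (for every face an embedding `τ'` and a `Sec42Data.BettiPinning` of THE PIN's tower module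
`(liuDictionaryPin … V (I V (repAt a) _) (line V (repAt a) _)).H` with its `ℂ[𝔾(𝔸_F^∞)]`-action to the Albanese Betti levels of `V`'s own
§4.2 datum along its Hecke translates), the AT-PLACE body of stub P: for every face with `hemb` and `hΦ` there are `τ'`, a tower module
`(H, rhoB)` with a Betti pinning, and its [Prop 4.13] theta decomposition over all labelled admissible triples of `muConj 𝕌_V` at `a` —
witnessed by the pin's own tower (`H :=` the pin module, `rhoB := Representation.ofModule' _`) and `bettiThetaDecomposition_pin_of_hyp413`
(p600376).  The v4 skeleton closes `stub_bettiThetaModelAtPlace_of : H413 → StubAlbaneseH1Comparison → StubPinBettiPinning →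
StubBettiThetaModelAtPlace` BY NAME as `fun h413 hcmp hpin => bettiThetaModelAtPlace_of_hyp413_of_pinning h413 (hpin hcmp)` (the bodies
below are the ruled texts with `CV`/`TV`/`UV` expanded verbatim; `H413` unfolds to `Hyp413`).  Theorems only; nothing of [Liu2021] is
asserted (hypotheses `h413`, `hpin`); HC_CM is proved only modulo the 7 printed citations until rung 0 closes.

## References
* [Liu2021] §4.2 l. 2074–2081 (the Betti tower `H¹_{B,τ'}(A_∞, ℂ)` and its Hecke action), Prop. 4.13 (l. 2110–2131), Thm. 4.18 proof
  l. 2254–2257.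
-/

set_option autoImplicit false

noncomputable section

namespace Summit.HodgeConjecture.CorCM.Lines.A3Liu418

open scoped TensorProduct Matrix
open NumberField NumberField.InfinitePlace
open HodgeCM.Model HodgeCM.Model.LiuIndex HodgeCM.Model.TowerCarrier
open HodgeCM.Literature.Theta.LiuAlbaneseModuleDatum.D2Bridge (HcmPieces)
open Summit.HodgeConjecture.CorCM.Model
open Literature.AlgebraicGeometry.Motives (CMType)
open Literature.AlgebraicGeometry.HodgeTheory Literature.NumberTheory.Automorphic.PicardCM
open Literature.AlgebraicGeometry.ShimuraVarieties.UnitaryCanonicalModel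
open Literature.NumberTheory.ComplexMultiplication
open Literature.NumberTheory.Automorphic
open Literature.NumberTheory.Automorphic.IdeleClassGroup (toHeckeCharacter isUnitary_toHeckeCharacter galConj)
open Literature.NumberTheory.Automorphic.Liu2021 Literature.NumberTheory.Automorphic.Liu2021.AppendixC
open Literature.NumberTheory.Automorphic.Liu2021.AppendixC.RestOne
open Literature.NumberTheory.Automorphic.Liu2021.Def411WeilCarriers (lineOf locF Rep)
open Summit.HodgeConjecture.CorCM.Transposition.OmegaTransport (realUnit)
open HodgeCM.Model.ArchSideTerm (e₁)
open Literature.NumberTheory.GelbartRogawski1991 Literature.NumberTheory.GelbartRogawski1991.UnitaryDualPair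
open Literature.NumberTheory.GelbartRogawski1991.UnitaryDualPair.LocalSplitting (localMu norm_localMu continuous_localMu localMu_toLocalRing_eq_one_iff
  eq_of_forall_localMu_toHeckeCharacter_eq)
open Literature.RepresentationTheory Literature.RepresentationTheory.Liu2021
open Summit.HodgeConjecture.CorCM.Transposition
open Summit.HodgeConjecture.CorCM.D2Bridge.AdapterMuConj (muConj prop413AsPrinted_muConj def411_muConj nontrivial_omegaAt_muConj_rest)
open Summit.HodgeConjecture.CorCM.D2Bridge.MuKeyIdentEnd (hc_cm_of_printed_citations_muKey_ident)
open Summit.HodgeConjecture.CorCM.D2Bridge.MuKeyIdentLemD3End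
open Summit.HodgeConjecture.CorCM.D2Bridge.MuKeyIdentLemD3DelRecConjOmegaEnd (diagonal_frameD_map_complexConj)

open Summit.HodgeConjecture.CorCM.D2Bridge.MuKeyIdentLemD3DelRecConjOmegaEndT (hc_cm_of_printed_citations_muKey_ident_lemD3_delRecConjOmegaT)
open scoped DirectSum

open Summit.HodgeConjecture.CorCM.Transposition.CentralTypeAtPin (exists_indexOfRecord_fst_eq repAt_fst_eq_of_fst_eq_mk)

/-- **Stub P at place ⇐ `Hyp413` + the pin's Betti pinning.**  If [Prop 4.13] AS PRINTED holds at the pin (`h413`, the binder `Hyp413` by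
name) and, at every face, THE PIN's tower module with its `ℂ[𝔾(𝔸_F^∞)]`-action is Betti-pinned along some `τ'` to the Albanese levels of
`V`'s own §4.2 datum (`hpin`, the consequent of the registered stub `StubPinBettiPinning`), then at every face with
`hemb : (mk ι₁).embedding = ι₁` and `hΦ : ι₁ ∈ Φ` there are `τ'`, a pinned tower module `(H, rhoB)` and its theta decomposition over all
labelled admissible triples of `muConj 𝕌_V` at `a` — namely the pin's own tower, decomposed by `bettiThetaDecomposition_pin_of_hyp413`.
[cite: Liu2021, §4.2 l. 2074–2081; Prop. 4.13 (FJcycle.tex l. 2110–2131); Thm. 4.18 proof l. 2254–2257] -/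
theorem bettiThetaModelAtPlace_of_hyp413_of_pinning
    (h413 : Summit.HodgeConjecture.CorCM.D2Bridge.MuKeyIdentLemD3DelRecConjOmegaEndT.PrintedCitationHypotheses.Hyp413)
    (hpin : ∀ (hDel : Literature.AlgebraicGeometry.ShimuraVarieties.UnitaryCanonicalModel.canonicalModel_exists_printed)
      (F : HodgeCM.CMField) [IsGalois ℚ F] (h6 : 6 ≤ Module.finrank ℚ F) {ι₁ : F →+* ℂ} (V : HodgeCM.HermSpace3 F ι₁) (a : RealScalar F) (Φ : CMType F),
      ∃ τ' : (F : Type) →+* ℂ, Nonempty ((sec42DataOf (Summit.HodgeConjecture.CorCM.DelRec.exists_recordSystem_of_printed hDel) isoOf ⟨HodgeCM.CMField.K F⟩ ι₁ ⟨HodgeCM.HermSpace3.Hm V, HodgeCM.HermSpace3.isHermitian V, HodgeCM.HermSpace3.signature_ι₁ V, HodgeCM.HermSpace3.posDef_of_ne V⟩ Φ).BettiPinning (heckeTranslatesFamilyOf heckeTranslate_definedOver_holds (Summit.HodgeConjecture.CorCM.DelRec.exists_recordSystem_of_printed hDel) isoOf ⟨HodgeCM.CMField.K F⟩ ι₁ ⟨HodgeCM.HermSpace3.Hm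 V, HodgeCM.HermSpace3.isHermitian V, HodgeCM.HermSpace3.signature_ι₁ V, HodgeCM.HermSpace3.posDef_of_ne V⟩ Φ h6) τ' ((liuDictionaryPin exists_isReal_hodgeModel_holds hodgePQ_independent_of_hodgeModel_holds BallQuotient.ballQuotientUniformised_holds (cmAbelianVarietyRealised_of_eigenbasis exists_isReal_hodgeModel_holds hodgePQ_independent_of_hodgeModel_holds cmAbelianVarietyEigenbasisRealised_holds) Literature.NumberTheory.Transcendental.arapura2012_cor_15_4_6_holds V (I V (repAt a) (muLiu ι₁ GramClass.rep)) (line V (repAt a) (muLiu ι₁ GramClass.rep)))).H (Representation.ofModule' _))) :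
    ∀ (hDel : Literature.AlgebraicGeometry.ShimuraVarieties.UnitaryCanonicalModel.canonicalModel_exists_printed)
      (F : HodgeCM.CMField) [IsGalois ℚ F] (h6 : 6 ≤ Module.finrank ℚ F) {ι₁ : F →+* ℂ} (V : HodgeCM.HermSpace3 F ι₁)
      (hemb : (NumberField.InfinitePlace.mk ι₁).embedding = ι₁) (a : RealScalar F) (Φ : CMType F) (hΦ : ι₁ ∈ Φ.1),
      ∃ (τ' : (F : Type) →+* ℂ) (H : Type) (_ : AddCommGroup H) (_ : Module ℂ H) (rhoB : Representation ℂ (sec42DataOf (Summit.HodgeConjecture.CorCM.DelRec.exists_recordSystem_of_printed hDel) isoOf ⟨HodgeCM.CMField.K F⟩ ι₁ ⟨HodgeCM.HermSpace3.Hm V, HodgeCM.HermSpace3.isHermitian V, HodgeCM.HermSpace3.signature_ι₁ V, HodgeCM.HermSpace3.posDef_of_ne V⟩ Φ).G H),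
        Nonempty ((sec42DataOf (Summit.HodgeConjecture.CorCM.DelRec.exists_recordSystem_of_printed hDel) isoOf ⟨HodgeCM.CMField.K F⟩ ι₁ ⟨HodgeCM.HermSpace3.Hm V, HodgeCM.HermSpace3.isHermitian V, HodgeCM.HermSpace3.signature_ι₁ V, HodgeCM.HermSpace3.posDef_of_ne V⟩ Φ).BettiPinning (heckeTranslatesFamilyOf heckeTranslate_definedOver_holds (Summit.HodgeConjecture.CorCM.DelRec.exists_recordSystem_of_printed hDel) isoOf ⟨HodgeCM.CMField.K F⟩ ι₁ ⟨HodgeCM.HermSpace3.Hm V, HodgeCM.HermSpace3.isHermitian V, HodgeCM.HermSpace3.signature_ι₁ V, HodgeCM.HermSpace3.posDef_of_ne V⟩ Φ h6) τ' H rhoB) ∧ BettiThetaDecomposition (Summit.HodgeConjecture.CorCM.D2Bridge.AdapterMuConj.muConj (uniformOmegaRep (Summit.HodgeConjecture.CorCM.DelRec.exists_recordSystem_of_printed hDel) ⟨HodgeCM.CMField.K F⟩ ι₁ ⟨HodgeCM.HermSpace3.Hm V, HodgeCM.HermSpace3.isHermitian V, HodgeCM.HermSpace3.signature_ι₁ V,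 HodgeCM.HermSpace3.posDef_of_ne V⟩ Φ e₁ (frameD V) (frameD_real V) (frameD_ne V) (ιVE V) (2 * imagUnit (HodgeCM.CMField.K F))⁻¹ (fun _ _ => (Rep.update ↥(maximalRealSubfield (HodgeCM.CMField.K F)) (imagUnitSq (HodgeCM.CMField.K F)) (Rep.ofLineOf ↥(maximalRealSubfield (HodgeCM.CMField.K F)) (imagUnitSq (HodgeCM.CMField.K F))) (locF ↥(maximalRealSubfield (HodgeCM.CMField.K F)) (imagUnitSq (HodgeCM.CMField.K F)) (realUnit ⟨HodgeCM.CMField.K F⟩ a.1 a.2.1 a.2.2)) (realUnit ⟨HodgeCM.CMField.K F⟩ a.1 a.2.1 a.2.2) rfl)))) H rhoB := by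
  intro hDel F _ h6 ι₁ V hemb a Φ hΦ
  obtain ⟨τ', hP⟩ := hpin hDel F h6 V a Φ
  exact ⟨τ', _, _, _, _, hP, bettiThetaDecomposition_pin_of_hyp413 h413 hDel F h6 V hemb a Φ hΦ⟩

/-- **The registered shape of the junction** (`stub_bettiThetaModelAtPlace_of : H413 → StubAlbaneseH1Comparison → StubPinBettiPinning →
StubBettiThetaModelAtPlace`, a3-liu418 v4): the same with the pinning supplied THROUGH an arbitrary antecedent `A` (in the skeleton
`A := StubAlbaneseH1Comparison`, row III-0, and `hpin := stub_pinBettiPinning`), so that the skeleton's stub is this theorem BY NAME.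
[cite: Liu2021, §4.2 l. 2074–2081; Prop. 4.13 (FJcycle.tex l. 2110–2131)] -/
theorem bettiThetaModelAtPlace_of_hyp413 {A : Prop}
    (h413 : Summit.HodgeConjecture.CorCM.D2Bridge.MuKeyIdentLemD3DelRecConjOmegaEndT.PrintedCitationHypotheses.Hyp413) (hcmp : A)
    (hpin : A → ∀ (hDel : Literature.AlgebraicGeometry.ShimuraVarieties.UnitaryCanonicalModel.canonicalModel_exists_printed)
      (F : HodgeCM.CMField) [IsGalois ℚ F] (h6 : 6 ≤ Module.finrank ℚ F) {ι₁ : F →+* ℂ} (V : HodgeCM.HermSpace3 F ι₁) (a : RealScalar F) (Φ : CMType F),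
      ∃ τ' : (F : Type) →+* ℂ, Nonempty ((sec42DataOf (Summit.HodgeConjecture.CorCM.DelRec.exists_recordSystem_of_printed hDel) isoOf ⟨HodgeCM.CMField.K F⟩ ι₁ ⟨HodgeCM.HermSpace3.Hm V, HodgeCM.HermSpace3.isHermitian V, HodgeCM.HermSpace3.signature_ι₁ V, HodgeCM.HermSpace3.posDef_of_ne V⟩ Φ).BettiPinning (heckeTranslatesFamilyOf heckeTranslate_definedOver_holds (Summit.HodgeConjecture.CorCM.DelRec.exists_recordSystem_of_printed hDel) isoOf ⟨HodgeCM.CMField.K F⟩ ι₁ ⟨HodgeCM.HermSpace3.Hm V, HodgeCM.HermSpace3.isHermitian V, HodgeCM.HermSpace3.signature_ι₁ V, HodgeCM.HermSpace3.posDef_of_ne V⟩ Φ h6) τ' ((liuDictionaryPin exists_isReal_hodgeModel_holds hodgePQ_independent_of_hodgeModel_holds BallQuotient.ballQuotientUniformised_holds (cmAbelianVarietyRealised_of_eigenbasis exists_isReal_hodgeModel_holds hodgePQ_independent_of_hodgeModel_holds cmAbelianVarietyEigenbasisRealised_holds) Literature.NumberTheory.Transcendental.arapura2012_cor_15_4_6_holds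 V (I V (repAt a) (muLiu ι₁ GramClass.rep)) (line V (repAt a) (muLiu ι₁ GramClass.rep)))).H (Representation.ofModule' _))) :
    ∀ (hDel : Literature.AlgebraicGeometry.ShimuraVarieties.UnitaryCanonicalModel.canonicalModel_exists_printed)
      (F : HodgeCM.CMField) [IsGalois ℚ F] (h6 : 6 ≤ Module.finrank ℚ F) {ι₁ : F →+* ℂ} (V : HodgeCM.HermSpace3 F ι₁)
      (hemb : (NumberField.InfinitePlace.mk ι₁).embedding = ι₁) (a : RealScalar F) (Φ : CMType F) (hΦ : ι₁ ∈ Φ.1),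
      ∃ (τ' : (F : Type) →+* ℂ) (H : Type) (_ : AddCommGroup H) (_ : Module ℂ H) (rhoB : Representation ℂ (sec42DataOf (Summit.HodgeConjecture.CorCM.DelRec.exists_recordSystem_of_printed hDel) isoOf ⟨HodgeCM.CMField.K F⟩ ι₁ ⟨HodgeCM.HermSpace3.Hm V, HodgeCM.HermSpace3.isHermitian V, HodgeCM.HermSpace3.signature_ι₁ V, HodgeCM.HermSpace3.posDef_of_ne V⟩ Φ).G H),
        Nonempty ((sec42DataOf (Summit.HodgeConjecture.CorCM.DelRec.exists_recordSystem_of_printed hDel) isoOf ⟨HodgeCM.CMField.K F⟩ ι₁ ⟨HodgeCM.HermSpace3.Hm V, HodgeCM.HermSpace3.isHermitian V, HodgeCM.HermSpace3.signature_ι₁ V, HodgeCM.HermSpace3.posDef_of_ne V⟩ Φ).BettiPinning (heckeTranslatesFamilyOf heckeTranslate_definedOver_holds (Summit.HodgeConjecture.CorCM.DelRec.exists_recordSystem_of_printed hDel) isoOf ⟨HodgeCM.CMField.K F⟩ ι₁ ⟨HodgeCM.HermSpace3.Hm V, HodgeCM.HermSpace3.isHermitian V, HodgeCM.HermSpace3.signature_ι₁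 V, HodgeCM.HermSpace3.posDef_of_ne V⟩ Φ h6) τ' H rhoB) ∧ BettiThetaDecomposition (Summit.HodgeConjecture.CorCM.D2Bridge.AdapterMuConj.muConj (uniformOmegaRep (Summit.HodgeConjecture.CorCM.DelRec.exists_recordSystem_of_printed hDel) ⟨HodgeCM.CMField.K F⟩ ι₁ ⟨HodgeCM.HermSpace3.Hm V, HodgeCM.HermSpace3.isHermitian V, HodgeCM.HermSpace3.signature_ι₁ V, HodgeCM.HermSpace3.posDef_of_ne V⟩ Φ e₁ (frameD V) (frameD_real V) (frameD_ne V) (ιVE V) (2 * imagUnit (HodgeCM.CMField.K F))⁻¹ (fun _ _ => (Rep.update ↥(maximalRealSubfield (HodgeCM.CMField.K F)) (imagUnitSq (HodgeCM.CMField.K F)) (Rep.ofLineOf ↥(maximalRealSubfield (HodgeCM.CMField.K F)) (imagUnitSq (HodgeCM.CMField.K F))) (locF ↥(maximalRealSubfield (HodgeCM.CMField.K F)) (imagUnitSq (HodgeCM.CMField.K F)) (realUnit ⟨HodgeCM.CMField.K F⟩ a.1 a.2.1 a.2.2)) (realUnit ⟨HodgeCM.CMField.K F⟩ a.1 a.2.1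 a.2.2) rfl)))) H rhoB :=
  bettiThetaModelAtPlace_of_hyp413_of_pinning h413 (hpin hcmp)

end Summit.HodgeConjecture.CorCM.Lines.A3Liu418

end
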